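import Literature.AlgebraicGeometry.Motives.ClosedGraphMorphism
import Literature.AlgebraicGeometry.Motives.CurveSymmetricChartInjective
import Literature.AlgebraicGeometry.RelativeSpec.FiniteGroupQuotientGluedProperties
import Literature.NumberTheory.DiophantineGeometry.FunctionFieldZetaRationalityProofs
import HarnessLib

/-!
# Linear systems define morphisms into the symmetric power of a curve
# (the master step of Weil's construction of the Jacobian, characteristic zero)

Let `C` be a smooth projective geometrically integral curve over an algebraically closed field `K`
of characteristic `0`, `C⁽ᵍ⁾ = Cᵍ/𝔖_g` its symmetric power (`Motives/SymmetricPowerProjective`).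
Weil's construction of the Jacobian (A. Weil 1948; J. S. Milne, *Jacobian Varieties*, §7) runs on
morphisms of the following shape: an (open piece of a) variety `T` parametrises divisor classes
`d(t)` of degree `g` on `C` with `ℓ(d(t)) = 1`, and `t ↦` "the unique effective divisor in the
class `d(t)`" is a MORPHISM `T ⊇ Ω → C⁽ᵍ⁾` — e.g. `(D, D') ↦ D″` with `D + D' ∼ D″ + gP`
(the birational group law on `C^{(g)}`, Milne §7 / Thm. 5.1 (a)), or its translates by divisors
of degree `0`. Milne obtains such maps over any field from the representability of `Div^r_C` by
`C^{(r)}` (Thm. 3.13) and of the sections of `Pic` of fixed `h⁰` (Prop. 4.2 (b)). Over an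
algebraically closed field of characteristic zero this file proves the statement DIRECTLY from

* upper semicontinuity of `h⁰` in families of divisors
  (`CechPseudoCoherentAt.isClosed_setOf_le_h0`, Görtz–Wedhorn II Cor. 23.135), and
* "a closed graph over a normal variety is the graph of a morphism"
  (`exists_hom_forall_comp_eq_of_isClosed`, `Motives/ClosedGraphMorphism`, Zariski's Main Theorem),

in the following MASTER form (`exists_hom_symPowProj_of_family`): let `ι : T' → T` be a morphism
from an integral normal `K`-scheme locally of finite type, `p : B → T` surjective and universally
closed ("parameters"), `D` a Cartier divisor on `C × (B × Cᵍ)` and `d : T(K) → Div(C_K)` a rule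
with `deg d(t) = g ≥ genus`, `ℓ(d(ι t')) = 1`, such that the fibre of `D` over the `K`-point
`(b, R₁, …, R_g)` has `h⁰ = ℓ(d(p b) − Σⱼ [Rⱼ])`. Then there is `ψ : T' → C⁽ᵍ⁾` with
`ψ(t') = [R₁ + ⋯ + R_g]` whenever `Σⱼ [Rⱼ] ∼ d(ι t')`. Indeed the locus `{1 ≤ h⁰} ⊆ B × Cᵍ` is
closed, hence so is its image `Γ ⊆ T' × C⁽ᵍ⁾`; the `K`-points of `Γ` are the `(t', E)` with
`E ∼ d(ι t')` effective (`deg = 0` and `ℓ ≥ 1` forces principal), i.e. the graph of a map, by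
`ℓ = 1`. `exists_hom_symPowProj_of_family_opens` is the case `T' = Ω ⊆ T` open.

Supporting results, all proved: `C⁽ⁿ⁾ → Spec K` is proper (`symPowProj.isProper_hom`);
`K`-points of non-empty closed subsets and lifting of `K`-points along surjections
(`AlgPoints.exists_pt_mem_of_isClosed`, `AlgPoints.exists_comp_eq_of_surjective`); `h⁰` of a
family at a field-valued point equals `h⁰` at its image point
(`h0_classPullback_fieldPoint_eq_fibre`); on function fields: `deg 0 ∧ ℓ ≥ 1 ⇒ principal`
(Stichtenoth Cor. 1.4.12), every place is rational over an algebraically closed constant field and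
an effective divisor of degree `n` is a sum of `n` places; on `C_K`: places are `K`-points of `C`
(`CurvePlaces.exists_place_ratPtPoint_eq`), a divisor of degree `n ≥ g` is linearly equivalent to
`Σⱼ [Rⱼ]` for an `n`-tuple of `K`-points (`exists_tuple_isLinearlyEquivalent`, Riemann's
inequality); `K`-points of `C⁽ᵍ⁾` are unordered tuples and, on classes with `ℓ = 1`, are
determined by the divisor class (`CurvePlaces.exists_tuplePt_mk_eq`,
`tuplePt_mk_eq_of_isLinearlyEquivalent`). No definitions and no named facts are introduced.

Mathlib searched (pin): `isInitialOfIsEmpty`, `isIntegral_of_isOpenImmersion`,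
`CartesianMonoidalCategory.lift_map`, `lift_whiskerRight`, `tensorHom_fst`, `Over.tensorHom_left`,
`JacobsonSpace.closure_inter_closedPoints_eq_closure`, `IsAlgClosed.algebraMap_bijective_of_isIntegral`
(all used); Mathlib has no symmetric powers of schemes and no linear systems.

## References

* J. S. Milne, *Jacobian Varieties*, Ch. VII of G. Cornell, J. H. Silverman (eds.), *Arithmetic
  Geometry*, Springer (1986): §3 Prop. 3.1, Thm. 3.13; §4 Prop. 4.2; §5 Thm. 5.1 (a); §7 (Weil's
  construction of the Jacobian). [Milne1986JacobianVarieties]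
* A. Weil, *Variétés abéliennes et courbes algébriques*, Hermann (1948).
* H. Stichtenoth, *Algebraic Function Fields and Codes*, 2nd ed. (2009): Def. 1.1.14, Cor. 1.4.12,
  Prop. 5.1.3. [Stichtenoth2009]
* U. Görtz, T. Wedhorn, *Algebraic Geometry II* (2023): Cor. 22.91, Cor. 23.135. [GortzWedhorn2023]
-/

noncomputable section

universe u

open CategoryTheory CategoryTheory.Limits AlgebraicGeometry TopologicalSpace Topology
  MonoidalCategory CartesianMonoidalCategory

namespace Literature.AlgebraicGeometry.Motives

open Literature.AlgebraicGeometry.RelativeSpec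

/-! ### §0 The symmetric power `C⁽ⁿ⁾` is proper -/

section SymPowProper

variable {K : Type u} [Field K]

/-- **`C⁽ⁿ⁾ → Spec K` is proper** for `C` projective over `K` (Milne, *Jacobian Varieties*, §3
Prop. 3.1: `C^{(r)}` is a complete variety): the glued quotient of the proper `Cⁿ` by `𝔖ₙ`
(`ActionOver.isProper_gluedDesc`). [cite: Milne1986JacobianVarieties, §3 Prop. 3.1] -/
theorem symPowProj.isProper_hom (C : SchemeOver K) (hC : IsProjectiveOver C) (n : ℕ) :
    IsProper (symPowProj C hC n).hom := by
  haveI := hC.isSeparated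
  haveI := hC.isProper
  haveI : IsLocallyNoetherian (Spec (.of K)) := inferInstance
  change IsProper (symPowGlued.base C.hom n)
  exact (permAction C.hom n).isProper_gluedDesc (exists_stableAffineOpen_mem hC.finiteSubsetsInAffineOpens)
    (powOver.base C.hom n) _ (𝟙 _) (Category.comp_id _)

/-- `C⁽ⁿ⁾ → Spec K` is locally of finite type. [folklore] -/
theorem symPowProj.locallyOfFiniteType_hom (C : SchemeOver K) (hC : IsProjectiveOver C) (n : ℕ)
    [IsProper C.hom] : LocallyOfFiniteType (symPowProj C hC n).hom :=
  haveI := symPowProj.isProper_hom C hC n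
  inferInstance

/-- `Cⁿ → C⁽ⁿ⁾` is finite. [folklore] -/
theorem symPowProj.isFinite_mk_left (C : SchemeOver K) (hC : IsProjectiveOver C) (n : ℕ) :
    IsFinite (symPowProj.mk C hC n).left := by
  haveI := hC.isSeparated
  haveI := hC.isProper
  change IsFinite (symPowGlued.mk C.hom n hC.finiteSubsetsInAffineOpens)
  exact (permAction C.hom n).isFinite_gluedMk _

/-- `Cⁿ → C⁽ⁿ⁾` is surjective. [folklore] -/
theorem symPowProj.surjective_mk_left (C : SchemeOver K) (hC : IsProjectiveOver C) (n : ℕ) :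
    Surjective (symPowProj.mk C hC n).left :=
  ⟨symPowProj.mk_surjective C hC n⟩

end SymPowProper

/-! ### §1 `K`-points: closed points of closed subsets, lifting along surjections -/

section KPoints

variable {K : Type u} [Field K] [IsAlgClosed K] {X Y : SchemeOver K} [LocallyOfFiniteType X.hom]

/-- Over an algebraically closed field, a non-empty closed subset of a `K`-scheme locally of finite
type contains the point of a `K`-point (closed points are dense in closed subsets of the Jacobson
space `X`, and closed points are `K`-points by the Nullstellensatz). [folklore] -/
theorem AlgPoints.exists_pt_mem_of_isClosed {Z : Set X.left} (hZ : IsClosed Z) (hne : Z.Nonempty) :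
    ∃ z : AlgPoints X K, z.pt ∈ Z := by
  haveI : JacobsonSpace X.left := LocallyOfFiniteType.jacobsonSpace X.hom
  have h : (Z ∩ closedPoints X.left).Nonempty := by
    by_contra h
    rw [Set.not_nonempty_iff_eq_empty] at h
    have h2 := JacobsonSpace.closure_inter_closedPoints_eq_closure hZ.isLocallyClosed
    rw [h, closure_empty, hZ.closure_eq] at h2
    exact hne.ne_empty h2.symm
  obtain ⟨x, hxZ, hxcl⟩ := h
  obtain ⟨z, rfl⟩ := AlgPoints.exists_pt_eq_of_isClosed_singleton (X := X) (mem_closedPoints_iff.mp hxcl)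
  exact ⟨z, hxZ⟩

/-- **`K`-points lift along surjective morphisms** (algebraically closed `K`, source locally of
finite type): for `p : X → Y` surjective and a `K`-point `y` of `Y` there is a `K`-point `x` of `X`
with `x ≫ p = y` (a closed point of the non-empty closed fibre `p⁻¹(y)`). [folklore] -/
theorem AlgPoints.exists_comp_eq_of_surjective [LocallyOfFiniteType Y.hom] (p : X ⟶ Y)
    [Surjective p.left] (y : AlgPoints Y K) : ∃ x : AlgPoints X K, x ≫ p = y := by
  obtain ⟨x₀, hx₀⟩ := p.left.surjective y.pt
  obtain ⟨x, hx⟩ := AlgPoints.exists_pt_mem_of_isClosed (X := X)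
    (IsClosed.preimage p.left.continuous y.isClosed_singleton_pt) ⟨x₀, hx₀⟩
  exact ⟨x, AlgPoints.eq_of_pt_eq (by rw [← AlgPoints.map_apply, AlgPoints.pt_map]; exact hx)⟩

omit [IsAlgClosed K] [LocallyOfFiniteType X.hom] in
/-- `pt (x ≫ p) = p (pt x)`. [folklore] -/
theorem AlgPoints.pt_comp (p : X ⟶ Y) (x : AlgPoints X K) : AlgPoints.pt (x ≫ p) = p.left x.pt := by
  rw [← AlgPoints.map_apply, AlgPoints.pt_map]

end KPoints

/-! ### §2 `h⁰` of a family at a field-valued point and at its image point -/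

section H0FieldPoint

variable {K : Type u} [Field K] (X T : SchemeOver K) [IsProper X.hom] [GeometricallyIntegral X.hom]
  [IsIntegral (X ⊗ T).left] (D : CartierDivisor (X ⊗ T).left)
  {L : Type u} [Field L] (π : Spec (.of L) ⟶ Spec (.of K)) (τ : Over.mk π ⟶ T)

/-- **`h⁰` of the family `D` on `X ×_K T` at a field-valued point `τ : Spec L → T` equals `h⁰` at
its image point `t₀ = τ(∗)`**: the `L`-dimension of `Γ(X_L, 𝒪(D_τ))` is the `κ(t₀)`-dimension of
`Γ(X_{κ(t₀)}, 𝒪(D_{t₀}))` (`τ` factors through `Spec κ(t₀)`, and `h⁰` is invariant under the field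
extension `L ⊇ κ(t₀)`, `h0_classPullback_whiskerLeft_fieldExt_eq`). [cite: GortzWedhorn2023, Cor. 22.91] -/
theorem h0_classPullback_fieldPoint_eq_fibre :
    letI := fibreOverField X π
    letI := fibreOverResidueField X T (τ.left (IsLocalRing.closedPoint L))
    (D.classPullback (X ◁ τ).left).h0 L =
      (D.classPullback (X ◁ residuePtι T (τ.left (IsLocalRing.closedPoint L))).left).h0
        (T.left.residueField (τ.left (IsLocalRing.closedPoint L))) := by
  letI := fibreOverField X π
  set t₀ := τ.left (IsLocalRing.closedPoint L)
  haveI : IsLocalHom (Scheme.stalkClosedPointTo τ.left).hom :=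
    Scheme.isLocalHom_stalkClosedPointTo' (R := L) τ.left
  -- the factorisation `Spec L → Spec κ(t₀)` of `τ`, as a `K`-morphism
  have hw : Spec.map (T.left.descResidueField (Scheme.stalkClosedPointTo τ.left)) ≫
      (residuePt T t₀).hom = π := by
    have h := Scheme.descResidueField_stalkClosedPointTo_fromSpecResidueField L _ τ.left
    change Spec.map _ ≫ (T.left.fromSpecResidueField _ ≫ T.hom) = π
    refine (Category.assoc _ _ _).symm.trans ?_
    refine (congrArg (· ≫ T.hom) h).trans ?_
    exact Over.w τ
  let m : Over.mk π ⟶ residuePt T t₀ :=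
    Over.homMk (Spec.map (T.left.descResidueField (Scheme.stalkClosedPointTo τ.left))) hw
  have hm : m ≫ residuePtι T t₀ = τ := by
    ext : 1
    exact Scheme.descResidueField_stalkClosedPointTo_fromSpecResidueField L _ τ.left
  have hcomp : (X ◁ τ).left = (X ◁ m).left ≫ (X ◁ residuePtι T t₀).left := by
    rw [← Over.comp_left, ← MonoidalCategory.whiskerLeft_comp, hm]
  rw [CartierDivisor.classPullback_congr hcomp,
    (D.classPullback_comp_linEquiv (X ◁ residuePtι T t₀).left (X ◁ m).left).h0_eq (K := L)]
  exact CartierDivisor.h0_classPullback_whiskerLeft_fieldExt_eq X m (D.classPullback (X ◁ residuePtι T t₀).left)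

/-- For a `K`-point `t` of `T`: `1 ≤ h⁰(D_t)` computed over `K` iff the point `pt t` lies in the
closed set `{t₀ | 1 ≤ h⁰(D_{t₀})}` of `CechPseudoCoherentAt.isClosed_setOf_le_h0`. [folklore] -/
theorem le_h0_classPullback_algPoint_iff (d : ℕ) (t : AlgPoints T K) :
    letI := fibreOverField X (Spec.map (CommRingCat.ofHom (algebraMap K K)))
    d ≤ (D.classPullback (X ◁ t).left).h0 K ↔
      t.pt ∈ {t₀ : T.left | letI := fibreOverResidueField X T t₀;
        d ≤ (D.classPullback (X ◁ residuePtι T t₀).left).h0 (T.left.residueField t₀)} := by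
  have e : t.pt = t.left (IsLocalRing.closedPoint K) := rfl
  rw [Set.mem_setOf_eq, e, ← h0_classPullback_fieldPoint_eq_fibre X T D _ t]

end H0FieldPoint

/-! ### §3 Divisors: degree-`0` classes with a section, effective divisors as sums of places -/

end Literature.AlgebraicGeometry.Motives

namespace Literature.NumberTheory.DiophantineGeometry.AlgFunctionField

variable {K : Type*} {F : Type*} [Field K] [Field F] [Algebra K F] [IsAlgFunctionField K F]

/-- **A divisor of degree `0` with `ℓ(D) ≥ 1` is principal** (Stichtenoth Cor. 1.4.12, the tree's
`ell_eq_zero_of_degree_eq_zero_of_not_isPrincipal` contraposed). [cite: Stichtenoth2009, Cor. 1.4.12] -/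
theorem Divisor.isPrincipal_of_degree_eq_zero_of_ell_ne_zero {D : Divisor K F} (h0 : D.degree = 0)
    (hD : ell D ≠ 0) : D.IsPrincipal := by
  by_contra h
  exact hD (ell_eq_zero_of_degree_eq_zero_of_not_isPrincipal h0 h)

/-- **Divisors of the same degree with `ℓ(D − D') ≥ 1` are linearly equivalent** (`D' ∼ D`). [cite: Stichtenoth2009, Cor. 1.4.12] -/
theorem Divisor.isLinearlyEquivalent_of_ell_sub_ne_zero {D D' : Divisor K F}
    (hdeg : D.degree = D'.degree) (h : ell (D - D') ≠ 0) : D'.IsLinearlyEquivalent D := by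
  have hp : (D - D').IsPrincipal :=
    Divisor.isPrincipal_of_degree_eq_zero_of_ell_ne_zero (by rw [map_sub, hdeg, sub_self]) h
  change (D' - D).IsPrincipal
  rw [← neg_sub]
  exact hp.neg

/-- `ℓ(D − D') ≥ 1` when `D' ∼ D`: for `(x) = D' − D` the function `x` lies in `ℒ(D − D')`. [cite: Stichtenoth2009, Cor. 1.4.12] -/
theorem Divisor.ell_sub_ne_zero_of_isLinearlyEquivalent {D D' : Divisor K F}
    (h : D'.IsLinearlyEquivalent D) : ell (D - D') ≠ 0 := by
  obtain ⟨x, hx0, hx⟩ := h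
  haveI := finiteDimensional_riemannRochSpace_of_isAlgFunctionField (K := K) (D - D')
  have hmem : x ∈ riemannRochSpace (D - D') := by
    rw [mem_riemannRochSpace_iff_nonneg _ hx0, hx]
    have e : D' - D + (D - D') = 0 := by abel
    rw [e]
  have hne : (⟨x, hmem⟩ : riemannRochSpace (D - D')) ≠ 0 := fun h' ↦ hx0 (congrArg Subtype.val h')
  exact (Module.finrank_pos_iff_exists_ne_zero.mpr ⟨_, hne⟩).ne'

/-- Linearly equivalent divisors have the same degree: deprecated alias of
`Divisor.degree_eq_of_isLinearlyEquivalent` (`FunctionFieldDivisorsNegativeDegreeProofs.lean`,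
Stichtenoth Cor. 1.4.12(a)), which this file already imports (dedup-02702). [folklore] -/
@[deprecated Divisor.degree_eq_of_isLinearlyEquivalent (since := "2026-08-17")]
alias Divisor.IsLinearlyEquivalent.degree_eq' := Divisor.degree_eq_of_isLinearlyEquivalent

/-- Over an algebraically closed constant field every place has degree one (its residue field is a
finite extension of `K`). [cite: Stichtenoth2009, Def. 1.1.14] -/
theorem PlaceOver.degree_eq_one_of_isAlgClosed' [IsAlgClosed K] (P : PlaceOver K F) : P.degree = 1 := by
  haveI : FiniteDimensional K P.residueField := PlaceOver.finiteDimensional_residueField_holds P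
  haveI : Algebra.IsIntegral K P.residueField := Algebra.IsIntegral.of_finite K P.residueField
  have hbij := IsAlgClosed.algebraMap_bijective_of_isIntegral (k := K) (K := P.residueField)
  change Module.finrank K P.residueField = 1
  have e : K ≃ₗ[K] P.residueField :=
    LinearEquiv.ofBijective (Algebra.linearMap K P.residueField) hbij
  rw [← e.finrank_eq, Module.finrank_self]

/-- Over an algebraically closed constant field, **an effective divisor of degree `n` is a sum of `n`
places** (with repetitions). [folklore] -/
theorem Divisor.exists_eq_sum_single_of_nonneg [IsAlgClosed K] :
    ∀ (n : ℕ) (A : Divisor K F), 0 ≤ A → A.degree = n →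
      ∃ v : Fin n → PlaceOver K F, A = ∑ j, Finsupp.single (v j) 1
  | 0, A, hA, hdeg => ⟨Fin.elim0, by
      rw [Divisor.eq_zero_of_nonneg_of_degree_eq_zero hA (by exact_mod_cast hdeg)]; simp⟩
  | n + 1, A, hA, hdeg => by
    classical
    -- a place in the support
    have hne : A ≠ 0 := by
      rintro rfl
      simp only [map_zero, Nat.cast_add, Nat.cast_one] at hdeg
      omega
    obtain ⟨P, hP⟩ : ∃ P, A P ≠ 0 := by
      by_contra h
      push Not at h
      exact hne (Finsupp.ext h)
    have hP0 : 0 < A P := lt_of_le_of_ne (by simpa using hA P) (Ne.symm hP)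
    have hA'nn : 0 ≤ A - Finsupp.single P 1 := by
      intro Q
      simp only [Finsupp.coe_zero, Pi.zero_apply, Finsupp.coe_sub, Pi.sub_apply, Finsupp.single_apply]
      split_ifs with hPQ
      · subst hPQ; omega
      · simpa using hA Q
    have hA'deg : (A - Finsupp.single P 1).degree = (n : ℤ) := by
      rw [map_sub, Divisor.degree_single, PlaceOver.degree_eq_one_of_isAlgClosed', hdeg]
      push_cast
      ring
    obtain ⟨v, hv⟩ := Divisor.exists_eq_sum_single_of_nonneg n _ hA'nn hA'deg
    refine ⟨Fin.cons P v, ?_⟩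
    rw [Fin.sum_univ_succ, Fin.cons_zero]
    simp only [Fin.cons_succ]
    rw [← hv]
    abel

end Literature.NumberTheory.DiophantineGeometry.AlgFunctionField

namespace Literature.AlgebraicGeometry.Motives

open Literature.AlgebraicGeometry.RelativeSpec

/-! ### §3b Places of `C_K` are `K`-points of `C` (algebraically closed `K`) -/

namespace CurvePlaces

open RatFn FieldPoint CartierDivisor Literature.NumberTheory.DiophantineGeometry
  Literature.NumberTheory.DiophantineGeometry.AlgFunctionField

variable {K : Type u} [Field K] (C : SchemeOver K)
  [SmoothOfRelativeDimension 1 C.hom] [IsProper C.hom] [GeometricallyIntegral C.hom]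

/-- `Spec K → Spec K` of `algebraMap K K` is the identity. [folklore] -/
theorem strPt_self : strPt (K := K) K = 𝟙 (Spec (.of K)) := by
  change Spec.map (CommRingCat.ofHom (algebraMap K K)) = _
  rw [Algebra.algebraMap_self, CommRingCat.ofHom_id, Spec.map_id]

/-- **Every place of `K(C_K)/K` is the place of a `K`-point of `C`** (algebraically closed `K`):
the centre of the place is a closed point of `C_K` (`pointOfPlace`), i.e. a `K`-point, whose first
projection is the required `K`-point of `C`. [folklore] -/
theorem exists_place_ratPtPoint_eq [IsAlgClosed K]
    (v : PlaceOver K (curveBC C (strPt (K := K) K)).left.functionField) :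
    ∃ Q : AlgPoints C K, place (curveBC C (strPt (K := K) K))
      (ratPtPoint C _ Q) (ratPtPoint_ne_genericPoint C _ Q) = v := by
  have hxg : pointOfPlace (C := curveBC C (strPt (K := K) K)) v ≠ genericPoint _ :=
    pointOfPlace_ne_genericPoint (C := curveBC C (strPt (K := K) K)) v
  have hxcl := isClosed_singleton (curveBC C (strPt (K := K) K)) hxg
  obtain ⟨z, hz⟩ := AlgPoints.exists_pt_eq_of_isClosed_singleton (X := curveBC C (strPt (K := K) K)) hxcl
  obtain ⟨zl, hzl⟩ : ∃ zl : Spec (.of K) ⟶ (C ⊗ Over.mk (strPt (K := K) K)).left, zl = z.left := ⟨_, rfl⟩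
  have hzsnd : zl ≫ fieldPointStr C (strPt (K := K) K) = 𝟙 _ := by
    have h : zl ≫ fieldPointStr C (strPt (K := K) K) = strPt (K := K) K := hzl ▸ Over.w z
    exact h.trans strPt_self
  have hw : (zl ≫ fieldPointFst C (strPt (K := K) K)) ≫ C.hom = strPt (K := K) K := by
    have hc : fieldPointFst C (strPt (K := K) K) ≫ C.hom =
        fieldPointStr C (strPt (K := K) K) ≫ strPt (K := K) K := pullback.condition
    rw [Category.assoc, hc, ← Category.assoc, hzsnd, Category.id_comp]
  let Q : AlgPoints C K := AlgPoints.mk (zl ≫ fieldPointFst C (strPt (K := K) K)) hw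
  have hrat : ratPt C (strPt (K := K) K) Q = zl := by
    apply pullback.hom_ext
    · exact (ratPt_fst C _ Q)
    · exact (ratPt_snd C _ Q).trans hzsnd.symm
  refine ⟨Q, ?_⟩
  have hpt : ratPtPoint C (strPt (K := K) K) Q = pointOfPlace (C := curveBC C (strPt (K := K) K)) v := by
    change ratPt C _ Q (IsLocalRing.closedPoint K) = _
    rw [hrat, hzl]
    exact hz
  rw [← place_pointOfPlace (C := curveBC C (strPt (K := K) K)) v]
  congr 1

/-- Over an algebraically closed `K`, **an effective divisor of degree `n` on `C_K` is the divisor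
`Σⱼ [Rⱼ]` of an `n`-tuple of `K`-points of `C`**. [folklore] -/
theorem exists_tuple_eq_sum_of_nonneg [IsAlgClosed K] {n : ℕ}
    {A : Divisor K (curveBC C (strPt (K := K) K)).left.functionField}
    (hA : 0 ≤ A) (hdeg : A.degree = n) :
    ∃ R : Fin n → AlgPoints C K, A = ∑ j, Finsupp.single (place (curveBC C _)
      (ratPtPoint C _ (R j)) (ratPtPoint_ne_genericPoint C _ (R j))) 1 := by
  obtain ⟨v, rfl⟩ := Divisor.exists_eq_sum_single_of_nonneg n A hA hdeg
  choose R hR using fun j ↦ exists_place_ratPtPoint_eq C (v j)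
  exact ⟨R, by simp only [hR]⟩

/-- **A divisor of degree `n ≥ g` on `C_K` is linearly equivalent to the divisor of an `n`-tuple of
`K`-points of `C`** (Riemann: `ℓ(A) ≥ deg A + 1 − g ≥ 1`, so the class of `A` contains an effective
divisor, `exists_nonneg_isLinearlyEquivalent`). [cite: Stichtenoth2009, Prop. 5.1.3 (proof, (5.1)–(5.2))] -/
theorem exists_tuple_isLinearlyEquivalent [IsAlgClosed K] {n : ℕ}
    {A : Divisor K (curveBC C (strPt (K := K) K)).left.functionField}
    (hdeg : A.degree = n) (hg : (genus K (curveBC C (strPt (K := K) K)).left.functionField : ℤ) ≤ n) :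
    ∃ R : Fin n → AlgPoints C K, Divisor.IsLinearlyEquivalent (∑ j, Finsupp.single (place (curveBC C _)
      (ratPtPoint C _ (R j)) (ratPtPoint_ne_genericPoint C _ (R j))) 1) A := by
  obtain ⟨A', hA', hlin⟩ := exists_nonneg_isLinearlyEquivalent (D := A) (by rw [hdeg]; exact hg)
  have hdeg' : A'.degree = n := by rw [Divisor.degree_eq_of_isLinearlyEquivalent hlin, hdeg]
  obtain ⟨R, hR⟩ := exists_tuple_eq_sum_of_nonneg C hA' hdeg'
  exact ⟨R, hR ▸ hlin⟩

/-! ### §4 `K`-points of `C⁽ᵍ⁾` are unordered `g`-tuples of `K`-points of `C` -/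

variable (g : ℕ) (hC : IsProjectiveOver C)

omit [SmoothOfRelativeDimension 1 C.hom] [IsProper C.hom] [GeometricallyIntegral C.hom] in
/-- A `K`-point of `Cᵍ` is the tuple of its coordinates. [folklore] -/
theorem tuplePt_comp_coord {L : Type u} [Field L] (π : Spec (.of L) ⟶ Spec (.of K))
    (τ : Over.mk π ⟶ powC C g) : tuplePt C π (fun j ↦ τ ≫ coord C g j) = τ :=
  hom_ext_projOver C.hom g _ _ fun j ↦ tuplePt_coord C π _ j

/-- **Every `K`-point of `C⁽ᵍ⁾` is the image of a `g`-tuple of `K`-points of `C`** (algebraically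
closed `K`: `K`-points lift along the surjection `Cᵍ → C⁽ᵍ⁾`). [cite: Milne1986JacobianVarieties, §3 Prop. 3.1] -/
theorem exists_tuplePt_mk_eq [IsAlgClosed K]
    (y : AlgPoints (symPowProj C hC g) K) :
    ∃ R : Fin g → AlgPoints C K, tuplePt C (strPt (K := K) K) R ≫ symPowProj.mk C hC g = y := by
  haveI := symPowProj.isProper_hom C hC g
  haveI := symPowProj.surjective_mk_left C hC g
  obtain ⟨τ, hτ⟩ := AlgPoints.exists_comp_eq_of_surjective (symPowProj.mk C hC g) y
  exact ⟨fun j ↦ τ ≫ coord C g j, by rw [tuplePt_comp_coord]; exact hτ⟩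

omit [SmoothOfRelativeDimension 1 C.hom] [IsProper C.hom] [GeometricallyIntegral C.hom] in
/-- The point of `C⁽ᵍ⁾` under the `K`-point `τ ≫ mk` is `mk (imagePtPow τ)`. [folklore] -/
theorem pt_comp_mk {L : Type u} [Field L] [Algebra K L] (τ : AlgPoints (powC C g) L) :
    AlgPoints.pt (τ ≫ symPowProj.mk C hC g) =
      (symPowProj.mk C hC g).left (imagePtPow C g (strPt (K := K) L) τ) := rfl

/-- **Tuples with the same divisor `Σⱼ [Rⱼ]` have the same image in `C⁽ᵍ⁾(K)`** (they differ by a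
permutation). [cite: Milne1986JacobianVarieties, §3 Prop. 3.1] -/
theorem tuplePt_mk_eq_of_coordDivisorAt_eq [IsAlgClosed K] {R R' : Fin g → AlgPoints C K}
    (h : coordDivisorAt C g (strPt (K := K) K) (tuplePt C _ R) =
      coordDivisorAt C g (strPt (K := K) K) (tuplePt C _ R')) :
    tuplePt C (strPt (K := K) K) R ≫ symPowProj.mk C hC g = tuplePt C _ R' ≫ symPowProj.mk C hC g := by
  haveI := symPowProj.isProper_hom C hC g
  apply AlgPoints.eq_of_pt_eq
  rw [pt_comp_mk, pt_comp_mk]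
  exact mk_imagePtPow_eq_of_coordDivisorAt_eq C g _ hC _ _ h

/-- **On classes with `ℓ = 1` the divisor CLASS of the tuple determines the point of `C⁽ᵍ⁾(K)`.**
[cite: Milne1986JacobianVarieties, §5 (proof of Thm. 5.1)] -/
theorem tuplePt_mk_eq_of_isLinearlyEquivalent [IsAlgClosed K] {R R' : Fin g → AlgPoints C K}
    (hlin : (coordDivisorAt C g (strPt (K := K) K) (tuplePt C _ R)).IsLinearlyEquivalent
      (coordDivisorAt C g (strPt (K := K) K) (tuplePt C _ R')))
    (hell : ell (coordDivisorAt C g (strPt (K := K) K) (tuplePt C _ R)) = 1) :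
    tuplePt C (strPt (K := K) K) R ≫ symPowProj.mk C hC g = tuplePt C _ R' ≫ symPowProj.mk C hC g := by
  haveI := symPowProj.isProper_hom C hC g
  apply AlgPoints.eq_of_pt_eq
  rw [pt_comp_mk, pt_comp_mk]
  exact mk_imagePtPow_eq_of_isLinearlyEquivalent C g _ hC _ _ hlin hell

/-- The coordinate divisor of a tuple is `Σⱼ [Rⱼ]`. [folklore] -/
theorem coordDivisorAt_tuplePt {L : Type u} [Field L] (π : Spec (.of L) ⟶ Spec (.of K))
    (R : Fin g → (Over.mk π ⟶ C)) :
    coordDivisorAt C g π (tuplePt C π R) = ∑ j, Finsupp.single (place (curveBC C π)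
      (ratPtPoint C π (R j)) (ratPtPoint_ne_genericPoint C _ (R j))) 1 := by
  simp only [coordDivisorAt, tuplePt_coord]

end CurvePlaces

/-! ### §5 The master theorem: linear-system morphisms into `C⁽ᵍ⁾` -/

section Master

open RatFn FieldPoint CartierDivisor Literature.NumberTheory.DiophantineGeometry
  Literature.NumberTheory.DiophantineGeometry.AlgFunctionField CurvePlaces

variable {K : Type u} [Field K]

/-- `(f ▷ T).left` is a base change of `f.left` (along the first projections). [folklore] -/
theorem isPullback_whiskerRight_left' {X X' : SchemeOver K} (f : X ⟶ X') (T : SchemeOver K) :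
    IsPullback (f ▷ T).left (pullback.fst X.hom T.hom) (pullback.fst X'.hom T.hom) f.left := by
  refine IsPullback.of_right ?_ (Over.whiskerRight_left_fst f) (IsPullback.of_hasPullback X'.hom T.hom).flip
  rw [Over.whiskerRight_left_snd, Over.w f]
  exact (IsPullback.of_hasPullback X.hom T.hom).flip

/-- `(f ⊗ g).left` is universally closed if `f.left` and `g.left` are. [folklore] -/
theorem universallyClosed_tensorHom_left {X X' Y Y' : SchemeOver K} (f : X ⟶ X') (g : Y ⟶ Y')
    [UniversallyClosed f.left] [UniversallyClosed g.left] : UniversallyClosed (f ⊗ₘ g).left := by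
  rw [tensorHom_def, Over.comp_left]
  haveI : UniversallyClosed (f ▷ Y).left :=
    MorphismProperty.of_isPullback (P := @UniversallyClosed) (isPullback_whiskerRight_left' f Y).flip inferInstance
  haveI : UniversallyClosed (X' ◁ g).left :=
    MorphismProperty.of_isPullback (P := @UniversallyClosed)
      (Limits.SubalgApprox.isPullback_whiskerLeft_left X' g).flip inferInstance
  infer_instance

variable {F : Type*} [Field F] [Algebra K F] [IsAlgFunctionField K F] in
/-- Linear equivalence is symmetric. [folklore] -/
theorem Divisor.IsLinearlyEquivalent.symm' {D D' : Divisor K F} (h : D.IsLinearlyEquivalent D') :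
    D'.IsLinearlyEquivalent D := by
  change (D' - D).IsPrincipal
  rw [← neg_sub]
  exact Divisor.IsPrincipal.neg h

variable {F : Type*} [Field F] [Algebra K F] [IsAlgFunctionField K F] in
/-- Linear equivalence is transitive. [folklore] -/
theorem Divisor.IsLinearlyEquivalent.trans' {D D' D'' : Divisor K F} (h : D.IsLinearlyEquivalent D')
    (h' : D'.IsLinearlyEquivalent D'') : D.IsLinearlyEquivalent D'' := by
  change (D - D'').IsPrincipal
  have e : D - D'' = (D - D') + (D' - D'') := by abel
  rw [e]
  exact Divisor.IsPrincipal.add h h'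

variable {F : Type*} [Field F] [Algebra K F] [IsAlgFunctionField K F] in
/-- Over an algebraically closed constant field a sum of `g` unit point masses has degree `g`. [folklore] -/
theorem Divisor.degree_sum_single_eq [IsAlgClosed K] {g : ℕ} (v : Fin g → PlaceOver K F) :
    Divisor.degree (∑ j, Finsupp.single (v j) (1 : ℤ)) = g := by
  rw [map_sum]
  simp only [Divisor.degree_single, PlaceOver.degree_eq_one_of_isAlgClosed', Nat.cast_one, mul_one,
    Finset.sum_const, Finset.card_univ, Fintype.card_fin, nsmul_eq_mul]

variable [IsAlgClosed K] [CharZero K]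
  (C : SchemeOver K) [IsIntegral C.left] [SmoothOfRelativeDimension 1 C.hom] [IsProper C.hom]
  [GeometricallyIntegral C.hom] (hC : IsProjectiveOver C) (hX : CechPseudoCoherentAt C) (g : ℕ)

omit [IsIntegral C.left] in
include hX in
/-- **Linear systems define morphisms into the symmetric power (the master theorem of Weil's
construction of the Jacobian, characteristic zero).** Let `C` be a smooth projective curve over an
algebraically closed field `K` of characteristic `0`, `T` an integral `K`-scheme locally of finite
type and `Ω ⊆ T` an open with normal local rings. Suppose given

* a `K`-scheme `B` with a surjective universally closed `p : B → T` ("parameters"),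
* a Cartier divisor `D` on `C × (B × Cᵍ)` — a family of divisors on `C` — and a rule `d`
  attaching to each `K`-point `t` of `T` a divisor `d(t)` of degree `g` on `C_K`, such that the fibre
  of `D` over the `K`-point `(b, (R₁, …, R_g))` has `h⁰ = ℓ(d(p b) − Σⱼ [Rⱼ])` (`hD`),
* `ℓ(d(t)) = 1` for the `K`-points `t` of `Ω`, and `g ≥ genus`.

Then there is a morphism of `K`-schemes `ψ : Ω → C⁽ᵍ⁾` sending each `K`-point `t` of `Ω` to THE
effective divisor linearly equivalent to `d(t)`: `ψ(t) = [R₁ + ⋯ + R_g]` whenever `Σⱼ [Rⱼ] ∼ d(t)`.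
Proof: the locus `{1 ≤ h⁰}` in `B × Cᵍ` is closed (semicontinuity,
`CechPseudoCoherentAt.isClosed_setOf_le_h0`), so is its image `Γ` in `Ω × C⁽ᵍ⁾` (`p × (Cᵍ → C⁽ᵍ⁾)`
is universally closed); its `K`-points are the pairs `(t, E)` with `E ∼ d(t)` effective
(`deg = 0` and `ℓ ≥ 1` means principal), i.e. — as `ℓ(d(t)) = 1` — the graph of a map on
`K`-points, and a closed graph over a normal variety in characteristic zero is the graph of a
morphism (`exists_hom_forall_comp_eq_of_isClosed`). This is how Weil's construction produces the
maps `C^{(g)} × C^{(g)} ⇢ C^{(g)}` of the birational group law and their translates (Milne,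
*Jacobian Varieties*, §7; there over any field via Thm. 3.13 and Prop. 4.2 (b)).
[cite: Milne1986JacobianVarieties, §7 (Weil's construction) with §4 Prop. 4.2 and §5 Thm. 5.1 (a)] -/
theorem exists_hom_symPowProj_of_family
    (T T' : SchemeOver K) (ι : T' ⟶ T) [IsIntegral T'.left] [LocallyOfFiniteType T'.hom]
    [LocallyOfFiniteType T.hom]
    (hTn : ∀ t : T'.left, IsIntegrallyClosed (T'.left.presheaf.stalk t))
    (B : SchemeOver K) [LocallyOfFiniteType B.hom] [IsIntegral (B ⊗ powC C g).left]
    [IsIntegral (C ⊗ (B ⊗ powC C g)).left]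
    (p : B ⟶ T) [Surjective p.left] [UniversallyClosed p.left]
    (D : CartierDivisor (C ⊗ (B ⊗ powC C g)).left)
    (d : AlgPoints T K → Divisor K (curveBC C (strPt (K := K) K)).left.functionField)
    (hD : ∀ β : AlgPoints (B ⊗ powC C g) K,
      letI := fibreOverField C (strPt (K := K) K)
      (D.classPullback (C ◁ β).left).h0 K =
        ell (d (β ≫ fst B (powC C g) ≫ p) -
          coordDivisorAt C g (strPt (K := K) K) (β ≫ snd B (powC C g))))
    (hdeg : ∀ t : AlgPoints T K, (d t).degree = g)
    (hΩ : ∀ t : AlgPoints T' K, ell (d (t ≫ ι)) = 1)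
    (hg : (genus K (curveBC C (strPt (K := K) K)).left.functionField : ℤ) ≤ g) :
    ∃ ψ : T' ⟶ symPowProj C hC g,
      ∀ (t : AlgPoints T' K) (R : Fin g → AlgPoints C K),
        Divisor.IsLinearlyEquivalent (coordDivisorAt C g (strPt (K := K) K) (tuplePt C _ R)) (d (t ≫ ι)) →
        t ≫ ψ = tuplePt C (strPt (K := K) K) R ≫ symPowProj.mk C hC g := by
  classical
  haveI := symPowProj.isProper_hom C hC g
  haveI := symPowProj.surjective_mk_left C hC g
  haveI := symPowProj.isFinite_mk_left C hC g
  -- the rule on `K`-points and its independence of the representative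
  have hex : ∀ x : AlgPoints T' K, ∃ R : Fin g → AlgPoints C K,
      Divisor.IsLinearlyEquivalent (coordDivisorAt C g (strPt (K := K) K) (tuplePt C _ R)) (d (x ≫ ι)) :=
    fun x ↦ by
      obtain ⟨R, hR⟩ := exists_tuple_isLinearlyEquivalent C (hdeg (x ≫ ι)) hg
      exact ⟨R, by rw [coordDivisorAt_tuplePt]; exact hR⟩
  choose R₀ hR₀ using hex
  have huniq : ∀ (x : AlgPoints T' K) (R : Fin g → AlgPoints C K),
      Divisor.IsLinearlyEquivalent (coordDivisorAt C g (strPt (K := K) K) (tuplePt C _ R)) (d (x ≫ ι)) →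
      tuplePt C (strPt (K := K) K) R ≫ symPowProj.mk C hC g =
        tuplePt C (strPt (K := K) K) (R₀ x) ≫ symPowProj.mk C hC g := fun x R hR ↦ by
    have h1 : Divisor.IsLinearlyEquivalent (coordDivisorAt C g (strPt (K := K) K) (tuplePt C _ R))
        (coordDivisorAt C g (strPt (K := K) K) (tuplePt C _ (R₀ x))) :=
      Divisor.IsLinearlyEquivalent.trans' hR (Divisor.IsLinearlyEquivalent.symm' (hR₀ x))
    have h2 : ell (coordDivisorAt C g (strPt (K := K) K) (tuplePt C _ R)) = 1 := by
      rw [ell_congr_of_isLinearlyEquivalent_holds hR]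
      exact hΩ x
    exact tuplePt_mk_eq_of_isLinearlyEquivalent C g hC h1 h2
  -- the closed locus `S = {1 ≤ h⁰}` of parameters with a section (semicontinuity)
  obtain ⟨S, hSdef⟩ : ∃ S : Set ↥(B ⊗ powC C g).left, S = {b | letI := fibreOverResidueField C (B ⊗ powC C g) b;
      1 ≤ (D.classPullback (C ◁ residuePtι (B ⊗ powC C g) b).left).h0
        ((B ⊗ powC C g).left.residueField b)} := ⟨_, rfl⟩
  have hS : IsClosed S := by
    rw [hSdef]
    exact CechPseudoCoherentAt.isClosed_setOf_le_h0 hX (B ⊗ powC C g) D 1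
  have hmemS : ∀ β : AlgPoints (B ⊗ powC C g) K, β.pt ∈ S ↔
      letI := fibreOverField C (strPt (K := K) K); 1 ≤ (D.classPullback (C ◁ β).left).h0 K := fun β ↦ by
    rw [hSdef]
    exact (le_h0_classPullback_algPoint_iff C (B ⊗ powC C g) D 1 β).symm
  -- its (closed) image in `T × C⁽ᵍ⁾` and the graph `Γ` in `T' × C⁽ᵍ⁾`
  haveI : UniversallyClosed (p ⊗ₘ symPowProj.mk C hC g).left := universallyClosed_tensorHom_left _ _
  have hS' : IsClosed ((p ⊗ₘ symPowProj.mk C hC g).left '' S) :=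
    (p ⊗ₘ symPowProj.mk C hC g).left.isClosedMap _ hS
  obtain ⟨Γ, hΓdef⟩ : ∃ Γ : Set ↥(T' ⊗ symPowProj C hC g).left,
      Γ = (ι ▷ symPowProj C hC g).left ⁻¹' ((p ⊗ₘ symPowProj.mk C hC g).left '' S) := ⟨_, rfl⟩
  have hΓ : IsClosed Γ := by rw [hΓdef]; exact hS'.preimage (Scheme.Hom.continuous _)
  -- the `K`-points of `Γ` are the pairs `(t, φ₀ t)`
  have hΓφ : ∀ (x : AlgPoints T' K) (y : AlgPoints (symPowProj C hC g) K),
      AlgPoints.pt (lift x y : AlgPoints (T' ⊗ symPowProj C hC g) K) ∈ Γ ↔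
        y = tuplePt C (strPt (K := K) K) (R₀ x) ≫ symPowProj.mk C hC g := by
    intro x y
    have e1 : AlgPoints.pt (lift x y : AlgPoints (T' ⊗ symPowProj C hC g) K) ∈ Γ ↔
        AlgPoints.pt (lift (x ≫ ι) y : AlgPoints (T ⊗ symPowProj C hC g) K) ∈
          (p ⊗ₘ symPowProj.mk C hC g).left '' S := by
      rw [hΓdef, Set.mem_preimage, ← AlgPoints.pt_comp, lift_whiskerRight]
    rw [e1]
    constructor
    · rintro ⟨b₀, hb₀S, hb₀⟩
      -- a `K`-point `β` of `B × Cᵍ` in `S` over `(x, y)`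
      obtain ⟨β, hβS, hβ⟩ : ∃ β : AlgPoints (B ⊗ powC C g) K, β.pt ∈ S ∧
          β ≫ (p ⊗ₘ symPowProj.mk C hC g) = lift (x ≫ ι) y := by
        obtain ⟨β, hβ⟩ := AlgPoints.exists_pt_mem_of_isClosed (X := B ⊗ powC C g)
          (hS.inter (IsClosed.preimage (p ⊗ₘ symPowProj.mk C hC g).left.continuous
            (AlgPoints.isClosed_singleton_pt (lift (x ≫ ι) y : AlgPoints (T ⊗ symPowProj C hC g) K))))
          ⟨b₀, hb₀S, hb₀⟩
        refine ⟨β, hβ.1, AlgPoints.eq_of_pt_eq ?_⟩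
        rw [AlgPoints.pt_comp]
        exact hβ.2
      have hb : β ≫ fst B (powC C g) ≫ p = x ≫ ι := by
        rw [← tensorHom_fst p (symPowProj.mk C hC g), ← Category.assoc, hβ, lift_fst]
      have hy : (β ≫ snd B (powC C g)) ≫ symPowProj.mk C hC g = y := by
        rw [Category.assoc, ← tensorHom_snd p (symPowProj.mk C hC g), ← Category.assoc, hβ, lift_snd]
      -- `h⁰ ≥ 1` at `β`: the coordinate divisor of `β` is linearly equivalent to `d(x)`
      have h1 := (hmemS β).mp hβS
      rw [hD β, hb] at h1
      have hlin : Divisor.IsLinearlyEquivalent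
          (coordDivisorAt C g (strPt (K := K) K) (β ≫ snd B (powC C g))) (d (x ≫ ι)) := by
        refine Divisor.isLinearlyEquivalent_of_ell_sub_ne_zero ?_ (Nat.one_le_iff_ne_zero.mp h1)
        rw [hdeg]
        exact (Divisor.degree_sum_single_eq _).symm
      rw [← tuplePt_comp_coord C g _ (β ≫ snd B (powC C g))] at hlin hy
      rw [← hy]
      exact huniq x _ hlin
    · rintro rfl
      obtain ⟨b, hb⟩ := AlgPoints.exists_comp_eq_of_surjective p (x ≫ ι)
      refine ⟨AlgPoints.pt (lift b (tuplePt C (strPt (K := K) K) (R₀ x)) : AlgPoints (B ⊗ powC C g) K), ?_, ?_⟩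
      · apply (hmemS _).mpr
        rw [hD, lift_fst_assoc, hb, lift_snd]
        exact Nat.one_le_iff_ne_zero.mpr (Divisor.ell_sub_ne_zero_of_isLinearlyEquivalent (hR₀ x))
      · rw [← AlgPoints.pt_comp, lift_map, hb]
  -- a closed graph over a normal variety is the graph of a morphism
  obtain ⟨ψ, hψ⟩ := exists_hom_forall_comp_eq_of_isClosed hTn Γ hΓ _ hΓφ
  exact ⟨ψ, fun t R hR ↦ by rw [hψ t]; exact (huniq t R hR).symm⟩

omit [IsIntegral C.left] in
include hX in
/-- **The master theorem on an open with normal local rings.** Same as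
`exists_hom_symPowProj_of_family`, for `T' = Ω ⊆ T` a non-empty open subset at whose points the
local rings of the integral `T` are integrally closed (the form in which it is applied to opens of
`C⁽ᵍ⁾ × C⁽ᵍ⁾`, of `C⁽ᵍ⁾` and of `Cᵍ` in Weil's construction). [cite: Milne1986JacobianVarieties, §7 (Weil's construction) with §4 Prop. 4.2 and §5 Thm. 5.1 (a)] -/
theorem exists_hom_symPowProj_of_family_opens
    (T : SchemeOver K) [IsIntegral T.left] [LocallyOfFiniteType T.hom] (Ω : T.left.Opens)
    (hΩ₀ : (Ω : Set T.left).Nonempty) (hTn : ∀ t ∈ Ω, IsIntegrallyClosed (T.left.presheaf.stalk t))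
    (B : SchemeOver K) [LocallyOfFiniteType B.hom] [IsIntegral (B ⊗ powC C g).left]
    [IsIntegral (C ⊗ (B ⊗ powC C g)).left]
    (p : B ⟶ T) [Surjective p.left] [UniversallyClosed p.left]
    (D : CartierDivisor (C ⊗ (B ⊗ powC C g)).left)
    (d : AlgPoints T K → Divisor K (curveBC C (strPt (K := K) K)).left.functionField)
    (hD : ∀ β : AlgPoints (B ⊗ powC C g) K,
      letI := fibreOverField C (strPt (K := K) K)
      (D.classPullback (C ◁ β).left).h0 K =
        ell (d (β ≫ fst B (powC C g) ≫ p) -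
          coordDivisorAt C g (strPt (K := K) K) (β ≫ snd B (powC C g))))
    (hdeg : ∀ t : AlgPoints T K, (d t).degree = g)
    (hΩ : ∀ t : AlgPoints T K, t.pt ∈ Ω → ell (d t) = 1)
    (hg : (genus K (curveBC C (strPt (K := K) K)).left.functionField : ℤ) ≤ g) :
    ∃ ψ : Over.mk (Ω.ι ≫ T.hom) ⟶ symPowProj C hC g,
      ∀ (t : AlgPoints (Over.mk (Ω.ι ≫ T.hom)) K) (R : Fin g → AlgPoints C K),
        Divisor.IsLinearlyEquivalent (coordDivisorAt C g (strPt (K := K) K) (tuplePt C _ R))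
          (d (t ≫ Over.homMk Ω.ι rfl)) →
        t ≫ ψ = tuplePt C (strPt (K := K) K) R ≫ symPowProj.mk C hC g := by
  haveI i0 : Nonempty (Over.mk (Ω.ι ≫ T.hom)).left := by
    obtain ⟨z, hz⟩ := hΩ₀
    exact ⟨(⟨z, hz⟩ : Ω)⟩
  haveI i1 : IsIntegral (Over.mk (Ω.ι ≫ T.hom)).left :=
    @isIntegral_of_isOpenImmersion (Ω : Scheme.{u}) T.left Ω.ι inferInstance inferInstance i0
  haveI i2 : LocallyOfFiniteType (Over.mk (Ω.ι ≫ T.hom)).hom :=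
    show LocallyOfFiniteType (Ω.ι ≫ T.hom) from inferInstance
  have hTn' : ∀ t : ↥(Over.mk (Ω.ι ≫ T.hom)).left,
      IsIntegrallyClosed ((Over.mk (Ω.ι ≫ T.hom)).left.presheaf.stalk t) := fun t ↦ by
    have h : IsIntegrallyClosed (T.left.presheaf.stalk (Ω.ι t)) := hTn _ (by simp)
    exact IsIntegrallyClosed.of_equiv (asIso (Ω.ι.stalkMap t)).commRingCatIsoToRingEquiv
  have hptΩ : ∀ x : AlgPoints (Over.mk (Ω.ι ≫ T.hom)) K,
      AlgPoints.pt (x ≫ Over.homMk Ω.ι rfl : AlgPoints T K) ∈ Ω := fun x ↦ by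
    rw [AlgPoints.pt_comp]
    exact (x.pt : Ω).2
  exact exists_hom_symPowProj_of_family C hC hX g T (Over.mk (Ω.ι ≫ T.hom)) (Over.homMk Ω.ι rfl) hTn'
    B p D d hD hdeg (fun t ↦ hΩ _ (hptΩ t)) hg

end Master

end Literature.AlgebraicGeometry.Motives

end
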